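import Mathlib

/-!
# `Balaban1983to89.B13RungDialNumerals` — T. Bałaban, *Renormalization group approach to lattice gauge field theories. II. Cluster
expansions*, Commun. Math. Phys. **116** (1988) 1–22 [Balaban1988RG2Cluster], p. 13 (the σ-cubes are taken «sufficiently far» from `Z₀`:
the source «O(1)e^{−⅓δ₀M}», `M` large), p. 15 («we have |A′|, |∇A′| < α₁, |𝐉| < α₀ … they are small … The general case is handled by a
perturbative argument»: the source «O(α₀ + α₁)», the configuration size small), (2.16) p. 16; T. Bałaban, *Propagators for lattice gauge
theories in a background field*, Commun. Math. Phys. **99** (1985) 389–434 [Balaban1985BackgroundPropagators], Thm 3.10 (3.107)–(3.108) p. 416: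
**THE RUNG's TWO DIALS AND PRINT's TWO PERTURBATIVE SOURCES AS LOCATED NUMERALS** — at the N10 junction of record (module 67 ∕ 67R
`Summits/…/BalabanUVNodesN10B13KernelTowerWalksEntrywiseNumeralsDecorated(Rates)`) the ACCRETIVITY RADIUS `R₁` and the EXCHANGE LETTER `θ₀` are
dials, and twelve binders couple them with the reference package `rf` and the configuration size `α`:
`{R₁} (hR₁ : 0 < R₁) (hR₁R : R₁ < rf.R) (hPσ : 8·K̄_P·c_V₀·e^{−ε_P R_σ} ≤ m₀) (hP₁ : 8·K̄_P·c_V₀·R₁ ≤ m₀·R) (hAσ : 8·K̄_A·c_V·e^{−ε_A R_σ} ≤ m_{A,0})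
(hA₁ : 8·K̄_A·c_V·R₁ ≤ m_{A,0}·R) (hαR : α < R₁) … {θ₀} (hθ₀ : 0 < θ₀) (hαsmall : α ≤ θ₀·R₁∕(4K̄+4))
(hRσlarge : log((4K̄+4)∕θ₀)∕(μ∕4 − κ_C⋆) ≤ R_σ) (hθle : θ₀ ≤ θ₀max)`.  THIS FILE eliminates both dials: ONE located SMALLNESS of the configuration size
`α ≤ alphaMax` and ONE located FAR-NESS `rsigmaMin ≤ R_σ` — print's two sources, p. 15 and p. 13, as two numerals of the honest letters.

statement-level skeleton of published theorems with citation tags; proofs where landed; nothing here is a claim about the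
Yang–Mills mass gap

CITATION HEADER.  [Balaban1988RG2Cluster] p. 15 (quoted above; the reference pair «(U, 0)» is symmetric and positive, the general case perturbative in
the small `A′, 𝐉`), p. 13 («we assume that dist(X, Z₀) > ⅔M» — the localization domains of the σ-expansion kept far from `Z₀`), p. 17 after (2.24) («Of course
we have assumed that α₅ is sufficiently small»), p. 21 («The assumptions allow finally us to fix all the constants, or rather bounds on these constants.»).
NOT PRINTED: the explicit thresholds below — print says «sufficiently small ∕ large»; the numerals are this file's bookkeeping of WHAT that has to mean for the
binders AS TYPED in the tree (NODE O's reference-rung currency `NodeOLettersOfWalksPerturbative.RefPackage`, `NodeOLettersOfWalksAcross.acrossSmall_of_walks_thresholds`: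
«α ≤ θ₀R∕(4K̄+4)» and «R_σ ≥ log((4K̄+4)∕θ₀)∕(ρ′ − κ_C)» for EVERY `θ₀ > 0`).

WHY THIS FILE (cell `pub-ymgap`, HUMAN RULING D-0062 Track A ∕ D-0149 width seats, node N10 = [B13], seat `pub-ymgap-dag-n10-w3` g2; the lane owner's census
`HOME/pub-ymgap-dag-n10-c/N10-RESIDUAL-CENSUS-v15.md`, classes «rung» and «(2.24)–(2.26)»).  Two facts make the elimination lossless up to the choice of `R₁`:
(a) the W-walks package `rf.toWalkPackage R₁` reads `R₁` ONLY in its field `R` — its numerals `K̄, μ, κ_C⋆, B_Γ, etaMax` and `PositiveRates` do not depend on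
`R₁` (`NodeOLettersOfWalksPerturbative.RefPackage.toWalkPackage`), so `R₁` enters the junction only through `hR₁ hR₁R hP₁ hA₁ hαR hαsmall`; (b) `θ₀` enters only
through `hθ₀ hθle hαsmall hRσlarge`, where `hαsmall` is MONOTONE and `hRσlarge` ANTITONE in `θ₀` (`μ∕4 − κ_C⋆ ≥ μ∕8 > 0`, `kapCStar_spec`) — so `θ₀ := θ₀max`
(n10-w1's `B13Bound226Numerals.theta0Max`) is the best admissible exchange letter (§4).  Pure real arithmetic over ABSTRACT letters
`(R, m₀, m_{A,0}, K̄_P, K̄_A, c_V, c_V₀, ε_P, ε_A, K̄, μ, κ_C, θ₀, α, R_σ)`; the junction edition instantiates `K̄ := (rf.toWalkPackage R₁⋆).Kbar` etc.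
Companions: `B13Bound226Numerals` (n10-w1: `θ₀max γ₂max M⁴min`), `B13EntrywiseBlockNumerals` (n10-w3: rate budget + floor), `B13InverseLettersNeumannRadius`
(n10-w2: thin radius of an inverse factor), `B13CondTowerAccretiveFloor` ∕ `B13CondTowerLocationNumerals` (n10-w4: accretivity floor, location numerals).

THE CHOICES (§1).  `R₁⋆ := radiusStar R m₀ m_{A,0} K̄_P K̄_A c_V c_V₀ := min(R∕2, m₀R∕(8K̄_Pc_V₀ + m₀), m_{A,0}R∕(8K̄_Ac_V + m_{A,0}))` — positive, `< R`, and
`hP₁ hA₁` hold AT it (§1); `alphaMax θ₀ R₁ K̄ := θ₀·R₁∕(4K̄+4)` — the `hαsmall` right side VERBATIM, so `hαsmall` IS the located inequality and `hαR` follows for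
`θ₀ < 4K̄+4` (§2); `rsigmaMin := max( log((4K̄+4)∕θ₀)∕(μ∕4 − κ_C), log((8K̄_Pc_V₀ + m₀)∕m₀)∕ε_P, log((8K̄_Ac_V + m_{A,0})∕m_{A,0})∕ε_A )` — `hRσlarge` verbatim as
the first member, `hPσ hAσ` from the other two for `ε_P, ε_A > 0` (§3).  §5 ★★ `rung_dials`: the NINE binders `hR₁ hR₁R hPσ hP₁ hAσ hA₁ hαR hαsmall hRσlarge` at
`R₁ := R₁⋆` from the sign letters + `α ≤ alphaMax θ₀ R₁⋆ K̄` + `rsigmaMin … ≤ R_σ`; §4 the `θ₀`-monotonicity; §6 A6 `exists_letters`.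
WHAT REMAINS DISPLAYED at the junction after this file (with `R₁ := R₁⋆`, `θ₀ := θ₀max`): `hα : α ≤ alphaMax θ₀max R₁⋆ K̄` («α sufficiently small», p. 15) and
`hRσ : rsigmaMin … θ₀max … ≤ rf.Rσ` («σ-cubes sufficiently far», p. 13), next to `hp hη` (positive input rates, admissible volume rate — `rf`'s own letters).
HONEST REMARK: `R₁⋆` is ONE admissible radius (any `R₁` with `hP₁ hA₁`, `R₁ < R` works; a larger admissible `R₁` only relaxes `hα`) — the dial form (§2–§3 at a
free `R₁`) is kept for a consumer who prefers another.

HONEST SCOPE.  Elementary real inequalities repackaging TYPED hypotheses of a landed junction; the `def`s are transparent numerals (no structure, no instance, no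
notation, no new named fact, D-0026); nothing of Bałaban's operators, kernels or constants is constructed or asserted, and no claim is made that Bałaban's
constants meet the thresholds; NODE O's files untouched; count-neutral; N10 NOT discharged; K1⁷ NOT closed; one finite four-torus programme at fixed ε per run;
nothing continuum ∕ ℝ⁴ ∕ OS ∕ mass-gap ∕ Clay.  No `sorry`.
-/

noncomputable section

namespace Literature.MathematicalPhysics.QuantumFieldTheory.Balaban1983to89.B13RungDialNumerals

/-! ## §1. The accretivity radius as a numeral of the reference letters; `hR₁ hR₁R hP₁ hA₁` at it -/

section Radius

variable (R m₀ mA KbarP KbarA cV cV₀ : ℝ)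

/-- NUMERAL (choice). The located ACCRETIVITY RADIUS `R₁⋆ := min(R∕2, m₀R∕(8K̄_Pc_V₀ + m₀), m_{A,0}R∕(8K̄_Ac_V + m_{A,0}))` — half the analyticity radius,
capped by the two division-free radius thresholds `hP₁`, `hA₁` of the rung. [cite: Balaban1988RG2Cluster, p.15, (2.16) p.16] -/
def radiusStar (R m₀ mA KbarP KbarA cV cV₀ : ℝ) : ℝ :=
  min (R / 2) (min (m₀ * R / (8 * KbarP * cV₀ + m₀)) (mA * R / (8 * KbarA * cV + mA)))

variable {R m₀ mA KbarP KbarA cV cV₀}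

/-- Binder `hR₁` at the numeral: `0 < R₁⋆` (for `R, m₀, m_{A,0} > 0`, `K̄_P c_V₀, K̄_A c_V ≥ 0` via `K̄_P, K̄_A, c_V, c_V₀ ≥ 0`).
[cite: Balaban1988RG2Cluster, p.15] -/
theorem radiusStar_pos (hR : 0 < R) (hm : 0 < m₀) (hmA : 0 < mA) (hKP : 0 ≤ KbarP) (hKA : 0 ≤ KbarA) (hcV : 0 ≤ cV) (hcV₀ : 0 ≤ cV₀) :
    0 < radiusStar R m₀ mA KbarP KbarA cV cV₀ := by
  unfold radiusStar
  refine lt_min (by positivity) (lt_min ?_ ?_)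
  · exact div_pos (mul_pos hm hR) (by positivity)
  · exact div_pos (mul_pos hmA hR) (by positivity)

/-- `R₁⋆ ≤ R∕2`. [cite: Balaban1988RG2Cluster, p.15] -/
theorem radiusStar_le_half : radiusStar R m₀ mA KbarP KbarA cV cV₀ ≤ R / 2 := min_le_left _ _

/-- Binder `hR₁R` at the numeral: `R₁⋆ < R` (for `R > 0`). [cite: Balaban1988RG2Cluster, p.15] -/
theorem radiusStar_lt (hR : 0 < R) : radiusStar R m₀ mA KbarP KbarA cV cV₀ < R :=
  radiusStar_le_half.trans_lt (by linarith)

/-- Binder `hP₁` at the numeral: `8·K̄_P·c_V₀·R₁⋆ ≤ m₀·R` (for `R ≥ 0`, `m₀ > 0`, `K̄_P, c_V₀ ≥ 0`). [cite: Balaban1988RG2Cluster, p.15, (2.16) p.16] -/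
theorem hP₁_radiusStar (hR : 0 ≤ R) (hm : 0 < m₀) (hKP : 0 ≤ KbarP) (hcV₀ : 0 ≤ cV₀) :
    8 * KbarP * cV₀ * radiusStar R m₀ mA KbarP KbarA cV cV₀ ≤ m₀ * R := by
  have hden : 0 < 8 * KbarP * cV₀ + m₀ := by positivity
  have hle : radiusStar R m₀ mA KbarP KbarA cV cV₀ ≤ m₀ * R / (8 * KbarP * cV₀ + m₀) :=
    (min_le_right _ _).trans (min_le_left _ _)
  have h8 : 0 ≤ 8 * KbarP * cV₀ := by positivity
  calc 8 * KbarP * cV₀ * radiusStar R m₀ mA KbarP KbarA cV cV₀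
      ≤ 8 * KbarP * cV₀ * (m₀ * R / (8 * KbarP * cV₀ + m₀)) := mul_le_mul_of_nonneg_left hle h8
    _ = (8 * KbarP * cV₀ / (8 * KbarP * cV₀ + m₀)) * (m₀ * R) := by ring
    _ ≤ 1 * (m₀ * R) := by
        refine mul_le_mul_of_nonneg_right ?_ (mul_nonneg hm.le hR)
        rw [div_le_one hden]; linarith
    _ = m₀ * R := one_mul _

/-- Binder `hA₁` at the numeral: `8·K̄_A·c_V·R₁⋆ ≤ m_{A,0}·R` (for `R ≥ 0`, `m_{A,0} > 0`, `K̄_A, c_V ≥ 0`). [cite: Balaban1988RG2Cluster, p.15, (2.16) p.16] -/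
theorem hA₁_radiusStar (hR : 0 ≤ R) (hmA : 0 < mA) (hKA : 0 ≤ KbarA) (hcV : 0 ≤ cV) :
    8 * KbarA * cV * radiusStar R m₀ mA KbarP KbarA cV cV₀ ≤ mA * R := by
  have hden : 0 < 8 * KbarA * cV + mA := by positivity
  have hle : radiusStar R m₀ mA KbarP KbarA cV cV₀ ≤ mA * R / (8 * KbarA * cV + mA) :=
    (min_le_right _ _).trans (min_le_right _ _)
  have h8 : 0 ≤ 8 * KbarA * cV := by positivity
  calc 8 * KbarA * cV * radiusStar R m₀ mA KbarP KbarA cV cV₀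
      ≤ 8 * KbarA * cV * (mA * R / (8 * KbarA * cV + mA)) := mul_le_mul_of_nonneg_left hle h8
    _ = (8 * KbarA * cV / (8 * KbarA * cV + mA)) * (mA * R) := by ring
    _ ≤ 1 * (mA * R) := by
        refine mul_le_mul_of_nonneg_right ?_ (mul_nonneg hmA.le hR)
        rw [div_le_one hden]; linarith
    _ = mA * R := one_mul _

end Radius

/-! ## §2. The configuration-size threshold («α sufficiently small», p. 15): `hαsmall` verbatim, `hαR` derived -/

section Alpha

variable (θ₀ R₁ Kbar : ℝ)

/-- NUMERAL (verbatim shape). The CONFIGURATION-SIZE threshold `alphaMax θ₀ R₁ K̄ := θ₀·R₁∕(4K̄+4)` — the right side of `hαsmall` (NODE O's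
`acrossSmall_of_walks_thresholds`: the bigger analyticity space, [II] p. 15). [cite: Balaban1988RG2Cluster, p.15] -/
def alphaMax (θ₀ R₁ Kbar : ℝ) : ℝ := θ₀ * R₁ / (4 * Kbar + 4)

variable {θ₀ R₁ Kbar}

/-- Binder `hαsmall` from the located smallness (they are the same inequality). [cite: Balaban1988RG2Cluster, p.15] -/
theorem hαsmall_of_le {α : ℝ} (hα : α ≤ alphaMax θ₀ R₁ Kbar) : α ≤ θ₀ * R₁ / (4 * Kbar + 4) := hα

/-- `alphaMax θ₀ R₁ K̄ < R₁` for `0 < R₁`, `K̄ ≥ 0` and `θ₀ < 4K̄ + 4` (in particular for every `θ₀ ≤ 1`). [cite: Balaban1988RG2Cluster, p.15] -/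
theorem alphaMax_lt (hR₁ : 0 < R₁) (hK : 0 ≤ Kbar) (hθ : θ₀ < 4 * Kbar + 4) : alphaMax θ₀ R₁ Kbar < R₁ := by
  unfold alphaMax
  have hden : 0 < 4 * Kbar + 4 := by positivity
  rw [div_lt_iff₀ hden]
  nlinarith

/-- Binder `hαR` from the located smallness: `α ≤ alphaMax ⟹ α < R₁` (`θ₀ < 4K̄ + 4`). [cite: Balaban1988RG2Cluster, p.15] -/
theorem hαR_of_le {α : ℝ} (hα : α ≤ alphaMax θ₀ R₁ Kbar) (hR₁ : 0 < R₁) (hK : 0 ≤ Kbar) (hθ : θ₀ < 4 * Kbar + 4) : α < R₁ :=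
  hα.trans_lt (alphaMax_lt hR₁ hK hθ)

/-- `0 < alphaMax` for positive letters (the threshold is not vacuous). [cite: Balaban1988RG2Cluster, p.15] -/
theorem alphaMax_pos (hθ : 0 < θ₀) (hR₁ : 0 < R₁) (hK : 0 ≤ Kbar) : 0 < alphaMax θ₀ R₁ Kbar := by
  unfold alphaMax; positivity

/-- The threshold is MONOTONE in the exchange letter `θ₀` and in the radius `R₁` (a larger admissible `θ₀` or `R₁` only relaxes it).
[cite: Balaban1988RG2Cluster, p.15] -/
theorem alphaMax_mono {θ₀' R₁' : ℝ} (hθ : θ₀ ≤ θ₀') (hR : R₁ ≤ R₁') (hθ0 : 0 ≤ θ₀) (hR0 : 0 ≤ R₁) (hK : 0 ≤ Kbar) :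
    alphaMax θ₀ R₁ Kbar ≤ alphaMax θ₀' R₁' Kbar := by
  unfold alphaMax
  have hden : 0 < 4 * Kbar + 4 := by positivity
  exact div_le_div_of_nonneg_right (mul_le_mul hθ hR hR0 (hθ0.trans hθ)) hden.le

end Alpha

/-! ## §3. The far-ness floor («σ-cubes sufficiently far from Z₀», p. 13): `hRσlarge` verbatim, `hPσ hAσ` derived -/

section Sigma

variable (θ₀ Kbar mu kapC m₀ mA KbarP KbarA cV cV₀ εP εA : ℝ)

/-- NUMERAL (verbatim shape). The EXCHANGE floor on `R_σ`: `log((4K̄+4)∕θ₀)∕(μ∕4 − κ_C)` — the left side of `hRσlarge` (NODE O's second threshold).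
[cite: Balaban1988RG2Cluster, p.13, (2.16) p.16] -/
def rsigmaX (θ₀ Kbar mu kapC : ℝ) : ℝ := Real.log ((4 * Kbar + 4) / θ₀) / (mu / 4 - kapC)

/-- NUMERAL. The floor making `hPσ : 8K̄_Pc_V₀e^{−ε_P R_σ} ≤ m₀` true: `log((8K̄_Pc_V₀ + m₀)∕m₀)∕ε_P` (no case split on `K̄_Pc_V₀ = 0`).
[cite: Balaban1988RG2Cluster, p.13, (2.16) p.16] -/
def rsigmaP (m₀ KbarP cV₀ εP : ℝ) : ℝ := Real.log ((8 * KbarP * cV₀ + m₀) / m₀) / εP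

/-- NUMERAL. The floor making `hAσ : 8K̄_Ac_Ve^{−ε_A R_σ} ≤ m_{A,0}` true: `log((8K̄_Ac_V + m_{A,0})∕m_{A,0})∕ε_A`.
[cite: Balaban1988RG2Cluster, p.13, (2.16) p.16] -/
def rsigmaA (mA KbarA cV εA : ℝ) : ℝ := Real.log ((8 * KbarA * cV + mA) / mA) / εA

/-- NUMERAL (choice). The located FAR-NESS floor `rsigmaMin := max(rsigmaX, max(rsigmaP, rsigmaA))`. [cite: Balaban1988RG2Cluster, p.13] -/
def rsigmaMin (θ₀ Kbar mu kapC m₀ mA KbarP KbarA cV cV₀ εP εA : ℝ) : ℝ :=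
  max (rsigmaX θ₀ Kbar mu kapC) (max (rsigmaP m₀ KbarP cV₀ εP) (rsigmaA mA KbarA cV εA))

variable {θ₀ Kbar mu kapC m₀ mA KbarP KbarA cV cV₀ εP εA}

/-- Binder `hRσlarge` from the located floor (its left side is the first member of the max). [cite: Balaban1988RG2Cluster, p.13, (2.16) p.16] -/
theorem hRσlarge_of_le {Rσ : ℝ} (h : rsigmaMin θ₀ Kbar mu kapC m₀ mA KbarP KbarA cV cV₀ εP εA ≤ Rσ) :
    Real.log ((4 * Kbar + 4) / θ₀) / (mu / 4 - kapC) ≤ Rσ :=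
  (le_max_left _ _).trans h

/-- The exponential mechanism: `K·e^{−εR_σ} ≤ m` as soon as `log((K + m)∕m)∕ε ≤ R_σ` (`K ≥ 0`, `m, ε > 0`). [folklore]
[cite: Balaban1988RG2Cluster, p.13] -/
theorem mul_exp_neg_le_of_log_le {K m ε Rσ : ℝ} (hK : 0 ≤ K) (hm : 0 < m) (hε : 0 < ε) (h : Real.log ((K + m) / m) / ε ≤ Rσ) :
    K * Real.exp (-(ε * Rσ)) ≤ m := by
  have hKm : 0 < K + m := by positivity
  have hlog : Real.log ((K + m) / m) ≤ ε * Rσ := by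
    rw [div_le_iff₀ hε] at h; linarith
  -- `e^{−εR_σ} ≤ m/(K+m)`
  have hexp : Real.exp (-(ε * Rσ)) ≤ m / (K + m) := by
    have h1 : Real.exp (-(ε * Rσ)) ≤ Real.exp (-Real.log ((K + m) / m)) := Real.exp_le_exp.2 (by linarith)
    have h2 : Real.exp (-Real.log ((K + m) / m)) = m / (K + m) := by
      rw [Real.exp_neg, Real.exp_log (div_pos hKm hm), inv_div]
    exact h1.trans_eq h2
  calc K * Real.exp (-(ε * Rσ)) ≤ K * (m / (K + m)) := mul_le_mul_of_nonneg_left hexp hK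
    _ = (K / (K + m)) * m := by ring
    _ ≤ 1 * m := by
        refine mul_le_mul_of_nonneg_right ?_ hm.le
        rw [div_le_one hKm]; linarith
    _ = m := one_mul _

/-- Binder `hPσ` from the located floor: `8K̄_Pc_V₀e^{−ε_P R_σ} ≤ m₀` (`K̄_P, c_V₀ ≥ 0`, `m₀, ε_P > 0`). [cite: Balaban1988RG2Cluster, p.13, (2.16) p.16] -/
theorem hPσ_of_le {Rσ : ℝ} (h : rsigmaMin θ₀ Kbar mu kapC m₀ mA KbarP KbarA cV cV₀ εP εA ≤ Rσ) (hKP : 0 ≤ KbarP) (hcV₀ : 0 ≤ cV₀)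
    (hm : 0 < m₀) (hεP : 0 < εP) : 8 * KbarP * cV₀ * Real.exp (-(εP * Rσ)) ≤ m₀ :=
  mul_exp_neg_le_of_log_le (by positivity) hm hεP (((le_max_left _ _).trans (le_max_right _ _)).trans h)

/-- Binder `hAσ` from the located floor: `8K̄_Ac_Ve^{−ε_A R_σ} ≤ m_{A,0}` (`K̄_A, c_V ≥ 0`, `m_{A,0}, ε_A > 0`). [cite: Balaban1988RG2Cluster, p.13, (2.16) p.16] -/
theorem hAσ_of_le {Rσ : ℝ} (h : rsigmaMin θ₀ Kbar mu kapC m₀ mA KbarP KbarA cV cV₀ εP εA ≤ Rσ) (hKA : 0 ≤ KbarA) (hcV : 0 ≤ cV)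
    (hmA : 0 < mA) (hεA : 0 < εA) : 8 * KbarA * cV * Real.exp (-(εA * Rσ)) ≤ mA :=
  mul_exp_neg_le_of_log_le (by positivity) hmA hεA (((le_max_right _ _).trans (le_max_right _ _)).trans h)

end Sigma

/-! ## §4. The exchange letter: both thresholds improve with `θ₀` — `θ₀ := θ₀max` is the best admissible choice -/

section Theta

variable {θ₀ θ₀' Kbar mu kapC : ℝ}

/-- The exchange floor is ANTITONE in `θ₀` on `0 < θ₀ ≤ θ₀'` when the rate gap `μ∕4 − κ_C` is positive (it is: `κ_C⋆ ≤ μ∕8`,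
`NodeOLettersOfWalksAcross.kapCStar_spec`) and `K̄ ≥ 0`. [cite: Balaban1988RG2Cluster, p.13, (2.16) p.16] -/
theorem rsigmaX_antitone (hθ : 0 < θ₀) (hle : θ₀ ≤ θ₀') (hK : 0 ≤ Kbar) (hgap : 0 < mu / 4 - kapC) :
    rsigmaX θ₀' Kbar mu kapC ≤ rsigmaX θ₀ Kbar mu kapC := by
  unfold rsigmaX
  have hθ' : 0 < θ₀' := hθ.trans_le hle
  refine div_le_div_of_nonneg_right (Real.log_le_log (by positivity) ?_) hgap.le
  exact div_le_div_of_nonneg_left (by positivity) hθ hle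

/-- Hence the whole far-ness floor is antitone in `θ₀`. [cite: Balaban1988RG2Cluster, p.13] -/
theorem rsigmaMin_antitone {m₀ mA KbarP KbarA cV cV₀ εP εA : ℝ} (hθ : 0 < θ₀) (hle : θ₀ ≤ θ₀') (hK : 0 ≤ Kbar)
    (hgap : 0 < mu / 4 - kapC) :
    rsigmaMin θ₀' Kbar mu kapC m₀ mA KbarP KbarA cV cV₀ εP εA ≤ rsigmaMin θ₀ Kbar mu kapC m₀ mA KbarP KbarA cV cV₀ εP εA := by
  unfold rsigmaMin
  exact max_le_max (rsigmaX_antitone hθ hle hK hgap) le_rfl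

/-- ★ **`θ₀ := θ₀max` IS WITHOUT LOSS**: if the two located conditions hold at some admissible `0 < θ₀ ≤ θ₀max` they hold at `θ₀max`
(`alphaMax` monotone, `rsigmaMin` antitone). [cite: Balaban1988RG2Cluster, p.13, p.15, (2.24) p.17] -/
theorem located_at_thetaMax_of_located {R₁ α Rσ m₀ mA KbarP KbarA cV cV₀ εP εA θmax : ℝ} (hθ : 0 < θ₀) (hle : θ₀ ≤ θmax)
    (hR₁ : 0 ≤ R₁) (hK : 0 ≤ Kbar) (hgap : 0 < mu / 4 - kapC)
    (hα : α ≤ alphaMax θ₀ R₁ Kbar) (hRσ : rsigmaMin θ₀ Kbar mu kapC m₀ mA KbarP KbarA cV cV₀ εP εA ≤ Rσ) :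
    α ≤ alphaMax θmax R₁ Kbar ∧ rsigmaMin θmax Kbar mu kapC m₀ mA KbarP KbarA cV cV₀ εP εA ≤ Rσ :=
  ⟨hα.trans (alphaMax_mono hle le_rfl hθ.le hR₁ hK), (rsigmaMin_antitone hθ hle hK hgap).trans hRσ⟩

end Theta

/-! ## §5. ★★ The bundle: the rung's nine dial binders from two located inequalities -/

section Bundle

variable {R m₀ mA KbarP KbarA cV cV₀ εP εA Kbar mu kapC θ₀ α Rσ : ℝ}

/-- ★★ **THE RUNG's DIALS AS LOCATED NUMERALS (dial `θ₀` free).**  For sign letters `0 < R`, `0 < m₀`, `0 < m_{A,0}`, `0 ≤ K̄_P, K̄_A, c_V, c_V₀`,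
`0 < ε_P, ε_A` (the reference package's admissibility + positive input rates), `0 ≤ K̄`, an exchange letter `θ₀ < 4K̄ + 4` (every `θ₀ ≤ 1`), and the TWO located
inequalities `α ≤ alphaMax θ₀ R₁⋆ K̄` (p. 15) and `rsigmaMin θ₀ K̄ μ κ_C m₀ m_{A,0} K̄_P K̄_A c_V c_V₀ ε_P ε_A ≤ R_σ` (p. 13), THERE IS a radius `R₁` (namely `R₁⋆`)
with ALL NINE binders `hR₁ hR₁R hPσ hP₁ hAσ hA₁ hαR hαsmall hRσlarge` of the N10 junction in their exact shapes (junction order).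
[cite: Balaban1988RG2Cluster, p.13, p.15, (2.16) p.16, p.21; Balaban1985BackgroundPropagators, Thm 3.10 p.416] -/
theorem rung_dials (hR : 0 < R) (hm : 0 < m₀) (hmA : 0 < mA) (hKP : 0 ≤ KbarP) (hKA : 0 ≤ KbarA) (hcV : 0 ≤ cV) (hcV₀ : 0 ≤ cV₀)
    (hεP : 0 < εP) (hεA : 0 < εA) (hK : 0 ≤ Kbar) (hθ4 : θ₀ < 4 * Kbar + 4)
    (hα : α ≤ alphaMax θ₀ (radiusStar R m₀ mA KbarP KbarA cV cV₀) Kbar)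
    (hRσ : rsigmaMin θ₀ Kbar mu kapC m₀ mA KbarP KbarA cV cV₀ εP εA ≤ Rσ) :
    ∃ R₁ : ℝ, 0 < R₁ ∧ R₁ < R ∧
      8 * KbarP * cV₀ * Real.exp (-(εP * Rσ)) ≤ m₀ ∧ 8 * KbarP * cV₀ * R₁ ≤ m₀ * R ∧
      8 * KbarA * cV * Real.exp (-(εA * Rσ)) ≤ mA ∧ 8 * KbarA * cV * R₁ ≤ mA * R ∧
      α < R₁ ∧ α ≤ θ₀ * R₁ / (4 * Kbar + 4) ∧
      Real.log ((4 * Kbar + 4) / θ₀) / (mu / 4 - kapC) ≤ Rσ := by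
  have hR₁ := radiusStar_pos hR hm hmA hKP hKA hcV hcV₀
  exact ⟨radiusStar R m₀ mA KbarP KbarA cV cV₀, hR₁, radiusStar_lt hR, hPσ_of_le hRσ hKP hcV₀ hm hεP,
    hP₁_radiusStar hR.le hm hKP hcV₀, hAσ_of_le hRσ hKA hcV hmA hεA, hA₁_radiusStar hR.le hmA hKA hcV,
    hαR_of_le hα hR₁ hK hθ4, hαsmall_of_le hα, hRσlarge_of_le hRσ⟩

/-- The same AT the numeral `R₁⋆` (no existential: the junction edition instantiates `R₁ := R₁⋆` literally, so that the R₁-independent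
package numerals `(rf.toWalkPackage R₁⋆).K̄ ∕ μ ∕ κ_C⋆` are the letters `K̄ μ κ_C` here). [cite: Balaban1988RG2Cluster, p.13, p.15, (2.16) p.16] -/
theorem rung_dials_at (hR : 0 < R) (hm : 0 < m₀) (hmA : 0 < mA) (hKP : 0 ≤ KbarP) (hKA : 0 ≤ KbarA) (hcV : 0 ≤ cV) (hcV₀ : 0 ≤ cV₀)
    (hεP : 0 < εP) (hεA : 0 < εA) (hK : 0 ≤ Kbar) (hθ4 : θ₀ < 4 * Kbar + 4)
    (hα : α ≤ alphaMax θ₀ (radiusStar R m₀ mA KbarP KbarA cV cV₀) Kbar)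
    (hRσ : rsigmaMin θ₀ Kbar mu kapC m₀ mA KbarP KbarA cV cV₀ εP εA ≤ Rσ) :
    0 < radiusStar R m₀ mA KbarP KbarA cV cV₀ ∧ radiusStar R m₀ mA KbarP KbarA cV cV₀ < R ∧
      8 * KbarP * cV₀ * Real.exp (-(εP * Rσ)) ≤ m₀ ∧ 8 * KbarP * cV₀ * radiusStar R m₀ mA KbarP KbarA cV cV₀ ≤ m₀ * R ∧
      8 * KbarA * cV * Real.exp (-(εA * Rσ)) ≤ mA ∧ 8 * KbarA * cV * radiusStar R m₀ mA KbarP KbarA cV cV₀ ≤ mA * R ∧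
      α < radiusStar R m₀ mA KbarP KbarA cV cV₀ ∧ α ≤ θ₀ * radiusStar R m₀ mA KbarP KbarA cV cV₀ / (4 * Kbar + 4) ∧
      Real.log ((4 * Kbar + 4) / θ₀) / (mu / 4 - kapC) ≤ Rσ := by
  have hR₁ := radiusStar_pos hR hm hmA hKP hKA hcV hcV₀
  exact ⟨hR₁, radiusStar_lt hR, hPσ_of_le hRσ hKP hcV₀ hm hεP, hP₁_radiusStar hR.le hm hKP hcV₀, hAσ_of_le hRσ hKA hcV hmA hεA,
    hA₁_radiusStar hR.le hmA hKA hcV, hαR_of_le hα hR₁ hK hθ4, hαsmall_of_le hα, hRσlarge_of_le hRσ⟩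

end Bundle

/-! ## §6. NON-VACUITY (A6): the located conditions are jointly inhabited, with room -/

section Witness

/-- The sign letters, the exchange letter and the two located inequalities are jointly inhabited: all package letters `1`, `K̄ = 0`, `μ = 8`,
`κ_C = 1` (gap `1 > 0`), `θ₀ = 1 < 4`, `α := alphaMax`, `R_σ := rsigmaMin`. [cite: Balaban1988RG2Cluster, p.13, p.15 (bookkeeping, not the paper's constants)] -/
theorem exists_letters :
    ∃ R m₀ mA KbarP KbarA cV cV₀ εP εA Kbar mu kapC θ₀ α Rσ : ℝ,
      0 < R ∧ 0 < m₀ ∧ 0 < mA ∧ 0 ≤ KbarP ∧ 0 ≤ KbarA ∧ 0 ≤ cV ∧ 0 ≤ cV₀ ∧ 0 < εP ∧ 0 < εA ∧ 0 ≤ Kbar ∧ 0 < θ₀ ∧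
      θ₀ < 4 * Kbar + 4 ∧ 0 < mu / 4 - kapC ∧ 0 < α ∧
      α ≤ alphaMax θ₀ (radiusStar R m₀ mA KbarP KbarA cV cV₀) Kbar ∧
      rsigmaMin θ₀ Kbar mu kapC m₀ mA KbarP KbarA cV cV₀ εP εA ≤ Rσ := by
  refine ⟨1, 1, 1, 1, 1, 1, 1, 1, 1, 0, 8, 1, 1, alphaMax 1 (radiusStar 1 1 1 1 1 1 1) 0,
    rsigmaMin 1 0 8 1 1 1 1 1 1 1 1 1, one_pos, one_pos, one_pos, zero_le_one, zero_le_one, zero_le_one, zero_le_one, one_pos, one_pos,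
    le_rfl, one_pos, by norm_num, by norm_num, ?_, le_rfl, le_rfl⟩
  exact alphaMax_pos one_pos (radiusStar_pos one_pos one_pos one_pos zero_le_one zero_le_one zero_le_one zero_le_one) le_rfl

/-- … hence the nine binder shapes themselves are jointly inhabited through `rung_dials` (sanity: the bundle fires).
[cite: Balaban1988RG2Cluster, p.13, p.15 (bookkeeping)] -/
theorem exists_binders :
    ∃ R m₀ mA KbarP KbarA cV cV₀ εP εA Kbar mu kapC θ₀ α Rσ R₁ : ℝ, 0 < θ₀ ∧ 0 < α ∧ 0 < R₁ ∧ R₁ < R ∧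
      8 * KbarP * cV₀ * Real.exp (-(εP * Rσ)) ≤ m₀ ∧ 8 * KbarP * cV₀ * R₁ ≤ m₀ * R ∧
      8 * KbarA * cV * Real.exp (-(εA * Rσ)) ≤ mA ∧ 8 * KbarA * cV * R₁ ≤ mA * R ∧
      α < R₁ ∧ α ≤ θ₀ * R₁ / (4 * Kbar + 4) ∧
      Real.log ((4 * Kbar + 4) / θ₀) / (mu / 4 - kapC) ≤ Rσ := by
  obtain ⟨R, m₀, mA, KbarP, KbarA, cV, cV₀, εP, εA, Kbar, mu, kapC, θ₀, α, Rσ, hR, hm, hmA, hKP, hKA, hcV, hcV₀, hεP, hεA, hK, hθ, hθ4,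
    -, hα0, hα, hRσ⟩ := exists_letters
  obtain ⟨R₁, h⟩ := rung_dials hR hm hmA hKP hKA hcV hcV₀ hεP hεA hK hθ4 hα hRσ
  exact ⟨R, m₀, mA, KbarP, KbarA, cV, cV₀, εP, εA, Kbar, mu, kapC, θ₀, α, Rσ, R₁, hθ, hα0, h⟩

end Witness

end Literature.MathematicalPhysics.QuantumFieldTheory.Balaban1983to89.B13RungDialNumerals

end
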